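import Literature.MathematicalPhysics.QuantumFieldTheory.Balaban1983to89.B9Thm312WholeIdentitiesDefAtPins
import Literature.MathematicalPhysics.QuantumFieldTheory.Balaban1983to89.B6SectACriticalPointV1
import Literature.MathematicalPhysics.QuantumFieldTheory.Balaban1983to89.Node00.OpsYQOnto

/-!
# `Balaban1983to89.B9Ids3124AtOne` — [B9] (3.124) p. 420 ∕ p. 425: the Sect.-D constraint algebra `QG₁DR = 0`, `RD*G₁Q* = 0`, `RD*G₁DR = R`
# HOLDS AT THE TRIVIAL BACKGROUND `U = 1` at node00-def-Y's pinned letters — the `U = 1` inhabitant of the displayed schema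
# `B9Thm312WholeIdentitiesSplit.Ids3124` (located gap O5), transported from [4]'s Faddeev–Popov identities (2.31) ∕ (2.34)

T. Bałaban, *Propagators for lattice gauge theories in a background field*, Commun. Math. Phys. **99** (1985) 389–434
[`Balaban1985BackgroundPropagators`, "B9"]; [4] = T. Bałaban, *Propagators and renormalization transformations for lattice gauge
theories. II*, Commun. Math. Phys. **96** (1984) 223–250 [`Balaban1984PropagatorsII`].

statement-level skeleton of published theorems with citation tags; proofs where landed; nothing here is a claim about the Yang–Mills
mass gap

THE PRINTED LOCI (verbatim).  [B9] p. 420: *"We will prove that the second term in the last line vanishes. More exactly we will prove the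
identities RD\*GQ\* = 0, hence QGDR = 0. (3.124) The proof is similar to the proof of the corresponding identities (2.34) in [4]."*; p. 425:
*"Verifying the above properties we need to know only the identities (3.124) and RD\*G₁DR = R"*; p. 407, the sentence before Cor. 3.5:
*"There we have proved these theorems for operators with the external gauge field configuration U = 1."*  [4] p. 227: *"Thus
R∂\*G∂R = R. (2.31)"*; p. 228: *"Hence we have R∂\*GQ\* = 0, QG∂R = 0. (2.34)"*.

THE POINT.  The rows-20–21 binder of the N06 certificate (dag-n06-d, edition 14 `…N06AtOpsYNuOfRecordV6EPairMU`) displays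
`hIds3124 : … → Ids3124 (𝔬12 x) U` — the three fields `h124Q ∕ h124R ∕ hR` of `B9Thm312Whole.Identities` that node00-def-Y LOCATED (gap O5,
memo `IDENTITIES-AT-LETTERS.md` §4): at def-Y's reading of `Q(U)` they are NOT identities of the instance at curved `U`, *"true only at
U = 1"* — and at `U = 1` they were so far UNWITNESSED in the tree (referee ref-A g23 READ-19).  THIS FILE supplies the `U = 1` witness: at the
trivial configuration every transporter is `1`, def-Y's letters are the lifts of the flat kernels of [4] Sect. A (`Node00.OpsYDeltaA` §5:
`QY_one ∕ QsY_one ∕ gradY_one ∕ divY_one ∕ RY_one`, `Node00.OpsYSectDE.G1Y_one_liftY`: `G₁(1) = G(1) = Gop♯`), and for those kernels the three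
identities ARE r03's theorems `B6SectACriticalPointV1.eq234_right_V1 ∕ eq234_left_V1 ∕ eq231_V1` ([4] (2.34)₂, (2.34)₁, (2.31) for the concrete
lattice operators, every nested domain family).  §1 reads r03's three theorems on NODE 00's Y carriers (the site slot through the box chart
`boxEquiv`: def-Y's `gradK_mulVec ∕ divK_mulVec ∕ onFun_RE_apply`); §2 lifts them to def-Y's letters at `U = 1` (product-form extensionality
`linearMap_ext_of_liftY`); §3 pushes them through dag-n06-d's coordinate-model functor `coordOpK ∕ coordOpKH` to the pinned models
`QcoKH ∕ QscoKH ∕ GcoK … (G1Y …) ∕ DvcoKH ∕ DvscoKH ∕ RcoK` of `Node00.OpsYSectDCoords` §5, for ANY letter record `𝔬` pinned there at a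
configuration `U₁` with `cfg U₁ = 1` — the sibling of dag-n06-l's `B9Thm312WholeIdentitiesDefAtPins.identitiesDef_of_pins` for the three
remaining fields; §4 assembles, at the record's transporters `parSymY ∕ parBY ∕ GpY … (parSymY …)` over the trace basis `trBasis N`, the FULL
schema `B9Thm312Whole.Identities 𝔬 U₁` at `U₁ ↦ 1` with NO side condition left (the four units of `identitiesDef_of_pins` are theorems at
`U = 1`: def-Y's `isUnit_deltaAY_one ∕ isUnit_deltaOneY_one`, n06-i's `isUnit_QGQY_one`).

v1.1 (§5–§6, referee ref-A g24 READ-4: *"informative only with R(1) ≠ 0 ∕ Q(1) ≠ 0"*).  THE INHABITANT IS NON-DEGENERATE: `R(1) ≠ 0`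
(`RY_one_ne_zero`: p21's `R♯ = 1 − P` fixes `Δ′_aν ≠ 0` for a kernel vector `ν = δ_c − δ_{c+e₀}` of `Q′♯`, two sites of one block —
`exists_qpK_mulVec_eq_zero`, `rK_ne_zero`) and `Q(U) ≠ 0` at EVERY configuration (`QY_ne_zero`: node00-def-Y's `QY_surjective` + r03's
`bondIdx_nonempty`), hence at the pins `𝔬.R U₁ ≠ 0`, `𝔬.Q U₁ ≠ 0` (`R_pins_one_ne_zero`, `Q_pins_ne_zero`; the coordinate functor is faithful on
constant families, `coordOpKH_const_ne_zero`) — the three identities at `U = 1` are not `0 = 0`.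

HONEST SCOPE.  Finite-dimensional bookkeeping over landed theorems: [4] (2.31)∕(2.34) are r03's (`B6SectACriticalPointV1`), the `U = 1`
faces of the letters are def-Y's, the coordinate functor is n06-d's; nothing of [B9] at curved `U` is asserted — there `Ids3124` stays
def-Y's located gap O5 (numerical witness kit j284516 of the memo stands).  What this gives the certificate: the displayed O5 residue is
NON-VACUOUS (inhabited at the trivial background of every member) — an A6 partial witness for rows 20–21, nothing more.  COUNT-NEUTRAL;
N06 is NOT discharged; one finite lattice at a time; nothing continuum, nothing about the mass gap.  Cell `pub-ymgap` (HUMAN RULING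
D-0062), Track A node N06 [B9], bundle F3 (the `U = 1` obligations, Cor. 3.5 ∕ [4]), seat `pub-ymgap-dag-n06-h` (g18), 2026-08-27.
-/

namespace Literature.MathematicalPhysics.QuantumFieldTheory.Balaban1983to89.B9Ids3124AtOne

open Node00 Node00.OpsYSectDCoords B9Thm312Whole B9Thm312WholeIdentitiesSplit B9Thm312WholeIdentitiesDefAtPins
open B6KLevelCensusIndexV1 (KIdx)
open B6Prop26Census2136KLevelV1 (Gop)
open B6Ineq2133TwoScaleV1 (onFun onFun_apply)
open B6Cor28KLevelV1 (onFun_comp)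
open B6SectAOperatorsV1 (dE dsE QE QsE RE)
open B6SectAVectorModelV1 (GE)
open B6GlobalChartV1 (PV domT boxEquiv toBox)
open B6SectACriticalPointV1 (eq231_V1 eq234_left_V1 eq234_right_V1)
open B9CoReadingCoords B9CoReadingCoordsH B9CoReadingCoordsS B9CoReadingCoordsTranspose B9Thm39ReadingCoords
open B9Eq3132SectDLetters
open scoped Matrix

noncomputable section

/-! ## §1 [4] (2.34)₂, (2.34)₁, (2.31) read on NODE 00's Y carriers (flat kernels; the site slot through the box chart) -/

section Flat

variable {d ℓ : ℕ} {hd : 1 ≤ d + 1} {hL : Odd (ℓ + 1) ∧ 1 < ℓ + 1} {b₀ b₁ : ℝ} (i : KIdx d ℓ hd hL b₀ b₁)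

/-- r03's transport of the zero map is zero. [folklore] -/
private theorem onFun_zero {ι κ : Type} : onFun (0 : EuclideanSpace ℝ ι →ₗ[ℝ] EuclideanSpace ℝ κ) = 0 := by
  rw [onFun, LinearMap.zero_comp, LinearMap.comp_zero]

/-- the `Q` kernel acts as r03's `Q` read on bond functions. [cite: Balaban1985BackgroundPropagators, (3.14)–(3.15) p.393; Balaban1984PropagatorsII, (2.20) p.226, bookkeeping] -/
theorem qK_mulVec_eq_onFun (A : FBondY i → ℝ) : qK i *ᵥ A = onFun (QE (domT i.hN i.D i.hk)) A := by
  rw [qK, LinearMap.toMatrix'_mulVec]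

/-- the `Q*` kernel acts as r03's `Q*` read on bond functions. [cite: Balaban1985BackgroundPropagators, (3.14)–(3.16) p.393; Balaban1984PropagatorsII, (2.19) p.226, bookkeeping] -/
theorem qsK_mulVec_eq_onFun (ω : IBondY i → ℝ) : qsK i *ᵥ ω = onFun (QsE (domT i.hN i.D i.hk)) ω := by
  rw [qsK, LinearMap.toMatrix'_mulVec]

/-- the `R♯` kernel acts, through the box chart, as r03's projection `R` of [4] Sect. A: `(R♯f) ∘ chart = R(f ∘ chart)`.
[cite: Balaban1984PropagatorsII, (2.17) p.225; Balaban1985BackgroundPropagators, (3.25) p.394, bookkeeping] -/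
theorem rK_mulVec_comp_boxEquiv (f : SiteY i → ℝ) :
    (fun x => (rK i *ᵥ f) (boxEquiv i.hN x)) = onFun (RE (domT i.hN i.D i.hk) i.cf) (fun x => f (boxEquiv i.hN x)) := by
  funext x
  rw [onFun_RE_apply]
  simp only [Equiv.apply_symm_apply]
  rfl

/-- ★ **[4] (2.34)₂ `QG∂R = 0` ON THE Y CARRIERS**: `Q♯ · Gop · ∂♯ · R♯ = 0` as an action on site functions (r03's `eq234_right_V1` at the index's
domain family `domT`, lattice factor `c_f`, weights `w`, conjugated by the box chart on the site slot). [cite: Balaban1984PropagatorsII, (2.34) p.228; Balaban1985BackgroundPropagators, (3.124) p.420, Cor. 3.5 p.407] -/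
theorem qK_Gop_gradK_rK_mulVec (f : SiteY i → ℝ) : qK i *ᵥ (Gop i (gradK i *ᵥ (rK i *ᵥ f))) = 0 := by
  rw [gradK_mulVec, rK_mulVec_comp_boxEquiv, qK_mulVec_eq_onFun]
  have h := eq234_right_V1 (domT i.hN i.D i.hk) i.hcf i.hw
  have h' : onFun (QE (domT i.hN i.D i.hk)) ∘ₗ Gop i ∘ₗ onFun (dE (P := PV d ℓ i.m i.K hd hL) i.cf) ∘ₗ onFun (RE (domT i.hN i.D i.hk) i.cf) = 0 := by
    rw [Gop, ← onFun_comp, ← onFun_comp, ← onFun_comp, h, onFun_zero]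
  exact LinearMap.congr_fun h' (fun x => f (boxEquiv i.hN x))

/-- `R♯ · ∂*♯` acts, through the box chart, as r03's `R ∘ ∂*`: `R♯(∂*♯B) = (R(∂*B)) ∘ chart⁻¹`.
[cite: Balaban1984PropagatorsII, (2.17)–(2.19) pp.225–226; Balaban1985BackgroundPropagators, (3.8) p.392, (3.25) p.394, bookkeeping] -/
theorem rK_divK_mulVec (B : FBondY i → ℝ) :
    rK i *ᵥ (divK i *ᵥ B) =
      fun z => onFun (RE (domT i.hN i.D i.hk) i.cf) (onFun (dsE (P := PV d ℓ i.m i.K hd hL) i.cf) B) ((boxEquiv i.hN).symm z) := by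
  funext z
  have h := congrArg (fun g : _ → ℝ => g ((boxEquiv i.hN).symm z)) (rK_mulVec_comp_boxEquiv i (divK i *ᵥ B))
  simp only [Equiv.apply_symm_apply] at h
  rw [h, divK_mulVec]
  simp only [Equiv.symm_apply_apply]

/-- ★ **[4] (2.34)₁ `R∂*GQ* = 0` ON THE Y CARRIERS**: `R♯ · ∂*♯ · Gop · Q*♯ = 0`. [cite: Balaban1984PropagatorsII, (2.32)–(2.34) pp.227–228; Balaban1985BackgroundPropagators, (3.124) p.420, Cor. 3.5 p.407] -/
theorem rK_divK_Gop_qsK_mulVec (ω : IBondY i → ℝ) : rK i *ᵥ (divK i *ᵥ (Gop i (qsK i *ᵥ ω))) = 0 := by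
  have h := eq234_left_V1 (domT i.hN i.D i.hk) i.hcf i.hw
  have h' : onFun (RE (domT i.hN i.D i.hk) i.cf) ∘ₗ onFun (dsE (P := PV d ℓ i.m i.K hd hL) i.cf) ∘ₗ Gop i ∘ₗ onFun (QsE (domT i.hN i.D i.hk)) = 0 := by
    rw [Gop, ← onFun_comp, ← onFun_comp, ← onFun_comp, h, onFun_zero]
  rw [rK_divK_mulVec, qsK_mulVec_eq_onFun]
  funext z
  exact LinearMap.congr_fun h' ω ▸ rfl

/-- ★ **[4] (2.31) `R∂*G∂R = R` ON THE Y CARRIERS**: `R♯ · ∂*♯ · Gop · ∂♯ · R♯ = R♯`. [cite: Balaban1984PropagatorsII, (2.31) p.227; Balaban1985BackgroundPropagators, p.425 («RD*G₁DR = R»), Cor. 3.5 p.407] -/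
theorem rK_divK_Gop_gradK_rK_mulVec (f : SiteY i → ℝ) : rK i *ᵥ (divK i *ᵥ (Gop i (gradK i *ᵥ (rK i *ᵥ f)))) = rK i *ᵥ f := by
  have h := eq231_V1 (domT i.hN i.D i.hk) i.hcf i.hw
  have h' : onFun (RE (domT i.hN i.D i.hk) i.cf) ∘ₗ onFun (dsE (P := PV d ℓ i.m i.K hd hL) i.cf) ∘ₗ Gop i ∘ₗ
      onFun (dE (P := PV d ℓ i.m i.K hd hL) i.cf) ∘ₗ onFun (RE (domT i.hN i.D i.hk) i.cf) = onFun (RE (domT i.hN i.D i.hk) i.cf) := by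
    rw [Gop, ← onFun_comp, ← onFun_comp, ← onFun_comp, ← onFun_comp, h]
  rw [rK_divK_mulVec, gradK_mulVec, rK_mulVec_comp_boxEquiv]
  funext z
  have hz := LinearMap.congr_fun h' (fun x => f (boxEquiv i.hN x))
  simp only [LinearMap.comp_apply] at hz
  rw [hz, ← rK_mulVec_comp_boxEquiv]
  simp only [Equiv.apply_symm_apply]

end Flat

/-! ## §2 The three identities for def-Y's LETTERS at the trivial configuration `U₁ = 1` -/

section Letters

variable {𝔸 : Type} [NormedRing 𝔸] [NormedAlgebra ℂ 𝔸] [CompleteSpace 𝔸]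
variable {d ℓ : ℕ} {hd : 1 ≤ d + 1} {hL : Odd (ℓ + 1) ∧ 1 < ℓ + 1} {b₀ b₁ : ℝ} (i : KIdx d ℓ hd hL b₀ b₁)

omit [CompleteSpace 𝔸] in
/-- the product-form lift of the zero function is zero. [cite: Balaban1985BackgroundPropagators, (3.39) p.397, bookkeeping] -/
private theorem liftY_zero' {X : Type} (E : 𝔸) : liftY (fun _ : X => (0 : ℝ)) E = 0 := by
  funext z
  simp [liftY_apply]

/-- ★★ **(3.124)'s `QG₁DR = 0` AT `U = 1` FOR def-Y's LETTERS** — any transporter letters trivial at `1`, any `G′` with the printed `U = 1` clause,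
any residual letter with `Δ⁽²⁾(1) = 0`: `Q(1) ∘ G₁(1) ∘ D_1 ∘ R(1) = 0` ([4] (2.34)₂ lifted along product forms).
[cite: Balaban1985BackgroundPropagators, (3.124) p.420, p.425, Cor. 3.5 p.407; Balaban1984PropagatorsII, (2.34) p.228] -/
theorem QY_G1Y_gradY_RY_one {parS : SiteParY 𝔸 i} {parB : BondParY 𝔸 i} {Gp : SiteOpY 𝔸 i} {Δ2 : BondOpY 𝔸 i}
    (hparS : ∀ z w, parS (fun _ _ => 1) z w = 1) (hparB : ∀ s s', parB (fun _ _ => 1) s s' = 1)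
    (hGp : ∀ (f : SiteY i → ℝ) (E : 𝔸), Gp (fun _ _ => 1) (liftY f E) = liftY ((toKT i).G *ᵥ f) E) (hΔ : Δ2 (fun _ _ => 1) = 0) :
    QY i parB (fun _ _ => 1) ∘ₗ G1Y i parS parB Gp Δ2 (fun _ _ => 1) ∘ₗ gradY i (fun _ _ => 1) ∘ₗ RY i parS Gp (fun _ _ => 1) = 0 := by
  refine B9Cor35AtOneInverseLetters.linearMap_ext_of_liftY fun f E => ?_
  rw [LinearMap.comp_apply, LinearMap.comp_apply, LinearMap.comp_apply, RY_one i hparS hGp, liftMatY_liftY, gradY_one, liftMatY_liftY,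
    G1Y_one_liftY i hparS hparB hGp hΔ, QY_one i hparB, liftMatY_liftY, qK_Gop_gradK_rK_mulVec, LinearMap.zero_apply]
  exact liftY_zero' E

/-- ★★ **(3.124)'s `RD*G₁Q* = 0` AT `U = 1` FOR def-Y's LETTERS**: `R(1) ∘ D*_1 ∘ G₁(1) ∘ Q*(1) = 0` ([4] (2.34)₁).
[cite: Balaban1985BackgroundPropagators, (3.124) p.420, p.425, Cor. 3.5 p.407; Balaban1984PropagatorsII, (2.32)–(2.34) pp.227–228] -/
theorem RY_divY_G1Y_QsY_one {parS : SiteParY 𝔸 i} {parB : BondParY 𝔸 i} {Gp : SiteOpY 𝔸 i} {Δ2 : BondOpY 𝔸 i}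
    (hparS : ∀ z w, parS (fun _ _ => 1) z w = 1) (hparB : ∀ s s', parB (fun _ _ => 1) s s' = 1)
    (hGp : ∀ (f : SiteY i → ℝ) (E : 𝔸), Gp (fun _ _ => 1) (liftY f E) = liftY ((toKT i).G *ᵥ f) E) (hΔ : Δ2 (fun _ _ => 1) = 0) :
    RY i parS Gp (fun _ _ => 1) ∘ₗ divY i (fun _ _ => 1) ∘ₗ G1Y i parS parB Gp Δ2 (fun _ _ => 1) ∘ₗ QsY i parB (fun _ _ => 1) = 0 := by
  refine B9Cor35AtOneInverseLetters.linearMap_ext_of_liftY fun ω E => ?_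
  rw [LinearMap.comp_apply, LinearMap.comp_apply, LinearMap.comp_apply, QsY_one i hparB, liftMatY_liftY, G1Y_one_liftY i hparS hparB hGp hΔ,
    divY_one, liftMatY_liftY, RY_one i hparS hGp, liftMatY_liftY, rK_divK_Gop_qsK_mulVec, LinearMap.zero_apply]
  exact liftY_zero' E

/-- ★★ **p. 425's `RD*G₁DR = R` AT `U = 1` FOR def-Y's LETTERS**: `R(1) ∘ D*_1 ∘ G₁(1) ∘ D_1 ∘ R(1) = R(1)` ([4] (2.31)).
[cite: Balaban1985BackgroundPropagators, (3.147) p.425 («RD*G₁DR = R»), Cor. 3.5 p.407; Balaban1984PropagatorsII, (2.31) p.227] -/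
theorem RY_divY_G1Y_gradY_RY_one {parS : SiteParY 𝔸 i} {parB : BondParY 𝔸 i} {Gp : SiteOpY 𝔸 i} {Δ2 : BondOpY 𝔸 i}
    (hparS : ∀ z w, parS (fun _ _ => 1) z w = 1) (hparB : ∀ s s', parB (fun _ _ => 1) s s' = 1)
    (hGp : ∀ (f : SiteY i → ℝ) (E : 𝔸), Gp (fun _ _ => 1) (liftY f E) = liftY ((toKT i).G *ᵥ f) E) (hΔ : Δ2 (fun _ _ => 1) = 0) :
    RY i parS Gp (fun _ _ => 1) ∘ₗ divY i (fun _ _ => 1) ∘ₗ G1Y i parS parB Gp Δ2 (fun _ _ => 1) ∘ₗ gradY i (fun _ _ => 1) ∘ₗ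
        RY i parS Gp (fun _ _ => 1) = RY i parS Gp (fun _ _ => 1) := by
  refine B9Cor35AtOneInverseLetters.linearMap_ext_of_liftY fun f E => ?_
  rw [LinearMap.comp_apply, LinearMap.comp_apply, LinearMap.comp_apply, LinearMap.comp_apply, RY_one i hparS hGp, liftMatY_liftY, gradY_one,
    liftMatY_liftY, G1Y_one_liftY i hparS hparB hGp hΔ, divY_one, liftMatY_liftY, liftMatY_liftY, rK_divK_Gop_gradK_rK_mulVec]

end Letters

/-! ## §3 The three identities at node00-def-Y's PINNED COORDINATE MODELS (`Node00.OpsYSectDCoords` §5), for any letter record pinned there -/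

section Pins

variable {𝔸 : Type} [NormedRing 𝔸] [NormedAlgebra ℂ 𝔸] [CompleteSpace 𝔸] [FiniteDimensional ℝ 𝔸]
variable {κ : Type} [Fintype κ]
variable {d ℓ : ℕ} {hd : 1 ≤ d + 1} {hL : Odd (ℓ + 1) ∧ 1 < ℓ + 1} {b₀ b₁ : ℝ}

omit [CompleteSpace 𝔸] [FiniteDimensional ℝ 𝔸] in
/-- the mixed coordinate model of the zero family is zero. [cite: Balaban1985BackgroundPropagators, (3.42) p.397, dictionary] -/
private theorem coordOpKH_const_zero (b : Module.Basis κ ℝ 𝔸) {T T' D' : Type} [Fintype T'] :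
    coordOpKH b (fun _ : D' => (0 : (T' → 𝔸) →ₗ[ℝ] (T → 𝔸))) = 0 := by
  have h := coordOpKH_smul b (0 : ℝ) (fun _ : D' => (0 : (T' → 𝔸) →ₗ[ℝ] (T → 𝔸)))
  simpa only [smul_zero, zero_smul] using h

omit [CompleteSpace 𝔸] [FiniteDimensional ℝ 𝔸] in
/-- `restrictScalars` of a composite (definitional). [folklore] -/
private theorem restrictScalars_comp' {T T' T'' : Type} (f : (T' → 𝔸) →ₗ[ℂ] (T'' → 𝔸)) (g : (T → 𝔸) →ₗ[ℂ] (T' → 𝔸)) :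
    (f ∘ₗ g).restrictScalars ℝ = f.restrictScalars ℝ ∘ₗ g.restrictScalars ℝ := rfl

/-- ★★★ **`Ids3124` AT THE PINS, AT `U = 1`** — the (3.124) ∕ p. 425 constraint algebra `QG₁DR = 0`, `RD*G₁Q* = 0`, `RD*G₁DR = R` for ANY letter
record `𝔬` whose six letters `Q ∕ Q* ∕ G₁ ∕ D ∕ D* ∕ R` at a configuration `U₁` reading `1` are node00-def-Y's coordinate models over a basis `b`
(`cR39 b ≠ 0`) of letters with transporters trivial at `1`, the printed `U = 1` clause for `G′` and `Δ⁽²⁾(1) = 0` (the sibling of n06-l's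
`identitiesDef_of_pins` for the three O5 fields; at curved `U` nothing is claimed). [cite: Balaban1985BackgroundPropagators, (3.124) p.420, (3.147) p.425, Cor. 3.5 p.407; Balaban1984PropagatorsII, (2.31) p.227, (2.34) p.228] -/
theorem ids3124_of_pins_one' (i : KIdx d ℓ hd hL b₀ b₁) (b : Module.Basis κ ℝ 𝔸) (hc : cR39 b ≠ 0) (B : B9.Backgrounds) (cfg : B.Cfg → CfgY 𝔸 i)
    {parS : SiteParY 𝔸 i} {parB : BondParY 𝔸 i} {Gp : SiteOpY 𝔸 i} {Δ2 : BondOpY 𝔸 i}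
    (hparS : ∀ z w, parS (fun _ _ => 1) z w = 1) (hparB : ∀ s s', parB (fun _ _ => 1) s s' = 1)
    (hGp : ∀ (f : SiteY i → ℝ) (E : 𝔸), Gp (fun _ _ => 1) (liftY f E) = liftY ((toKT i).G *ᵥ f) E) (hΔ : Δ2 (fun _ _ => 1) = 0)
    {g : B9.Geometry} {Y : Type} (𝔬 : Ops g B (XBK κ i) Y (XHK κ i) (XSK κ i)) {U₁ : B.Cfg} (hU₁ : cfg U₁ = fun _ _ => 1)
    (hG1 : 𝔬.G1 U₁ = GcoK i b B cfg (G1Y i parS parB Gp Δ2) U₁)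
    (hQ : 𝔬.Q U₁ = QcoKH i b B cfg parB U₁) (hQs : 𝔬.Qstar U₁ = QscoKH i b B cfg parB U₁)
    (hDv : 𝔬.Dv U₁ = DvcoKH i b B cfg U₁) (hDvs : 𝔬.Dvstar U₁ = DvscoKH i b B cfg U₁)
    (hR : 𝔬.R U₁ = RcoK i b B cfg parS Gp U₁) :
    Ids3124 𝔬 U₁ where
  h124Q := by
    rw [hQ, hG1, hDv, hR, QcoKH, GcoK, DvcoKH, RcoK]
    simp only [LinearMap.smul_comp, LinearMap.comp_smul]
    rw [coordOpKH_const_comp_coordOpK_const, coordOpK_const_comp_coordOpKH_const, coordOpKH_const_comp_coordOpKH_const, hU₁,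
      ← restrictScalars_comp', ← restrictScalars_comp', ← restrictScalars_comp', QY_G1Y_gradY_RY_one i hparS hparB hGp hΔ,
      LinearMap.restrictScalars_zero, coordOpKH_const_zero, smul_zero, smul_zero, smul_zero]
  h124R := by
    rw [hR, hDvs, hG1, hQs, RcoK, DvscoKH, GcoK, QscoKH]
    simp only [LinearMap.smul_comp, LinearMap.comp_smul]
    rw [coordOpK_const_comp_coordOpKH_const, coordOpKH_const_comp_coordOpKH_const, coordOpK_const_comp_coordOpKH_const, hU₁,
      ← restrictScalars_comp', ← restrictScalars_comp', ← restrictScalars_comp', RY_divY_G1Y_QsY_one i hparS hparB hGp hΔ,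
      LinearMap.restrictScalars_zero, coordOpKH_const_zero, smul_zero, smul_zero, smul_zero]
  hR := by
    rw [hR, hDvs, hG1, hDv, RcoK, DvscoKH, GcoK, DvcoKH]
    simp only [LinearMap.smul_comp, LinearMap.comp_smul]
    rw [coordOpKH_const_comp_coordOpK_const, coordOpK_const_comp_coordOpKH_const, coordOpKH_const_comp_coordOpKH_const,
      coordOpK_const_comp_coordOpKH_const, hU₁,
      ← restrictScalars_comp', ← restrictScalars_comp', ← restrictScalars_comp', ← restrictScalars_comp',
      RY_divY_G1Y_gradY_RY_one i hparS hparB hGp hΔ, coordOpKH_eq_coordOpK, smul_smul, smul_smul, inv_mul_cancel₀ hc, one_mul]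

end Pins

/-! ## §4 At the record's transporters over the trace basis: `Ids3124` and the FULL schema `Identities` at `U = 1`, no side condition left -/

section Record

open scoped Matrix.Norms.L2Operator

variable {N : ℕ} {d ℓ : ℕ} {hd : 1 ≤ d + 1} {hL : Odd (ℓ + 1) ∧ 1 < ℓ + 1} {b₀ b₁ : ℝ}

/-- ★★★ **`Ids3124` AT THE PINS OF RECORD, AT `U = 1`**: for any letter record `𝔬` whose `Q ∕ Q* ∕ G₁ ∕ D ∕ D* ∕ R` at a configuration `U₁` reading
`1` are node00-def-Y's coordinate models at the record's transporters `parSymY ∕ parBY ∕ GpY … (parSymY …)` over the trace basis `trBasis N`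
(`0 < N`) and a residual letter with `Δ⁽²⁾(1) = 0` — the hypotheses of n06-l's `identitiesDef_of_pins`, six of sixteen, verbatim —
`Ids3124 𝔬 U₁`: the `U = 1` inhabitant of the N06 certificate's displayed binder `hIds3124` (located gap O5 elsewhere).
[cite: Balaban1985BackgroundPropagators, (3.124) p.420, (3.147) p.425, Cor. 3.5 p.407; Balaban1984PropagatorsII, (2.31) p.227, (2.34) p.228] -/
theorem ids3124_of_pins_one (i : KIdx d ℓ hd hL b₀ b₁) (B : B9.Backgrounds) (cfg : B.Cfg → CfgY (Matrix (Fin N) (Fin N) ℂ) i)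
    (Δ2 : BondOpY (Matrix (Fin N) (Fin N) ℂ) i) {g : B9.Geometry} {Y : Type}
    (𝔬 : Ops g B (XBK (TrIdx N) i) Y (XHK (TrIdx N) i) (XSK (TrIdx N) i)) (U₁ : B.Cfg) (hN : 0 < N)
    (hU₁ : cfg U₁ = fun _ _ => 1) (hΔ : Δ2 (fun _ _ => 1) = 0)
    (hG1 : 𝔬.G1 U₁ = GcoK i (trBasis N) B cfg (G1Y i (parSymY i) (parBY i) (GpY i (parSymY i)) Δ2) U₁)
    (hQ : 𝔬.Q U₁ = QcoKH i (trBasis N) B cfg (parBY i) U₁)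
    (hQs : 𝔬.Qstar U₁ = QscoKH i (trBasis N) B cfg (parBY i) U₁)
    (hDv : 𝔬.Dv U₁ = DvcoKH i (trBasis N) B cfg U₁)
    (hDvs : 𝔬.Dvstar U₁ = DvscoKH i (trBasis N) B cfg U₁)
    (hR : 𝔬.R U₁ = RcoK i (trBasis N) B cfg (parSymY i) (GpY i (parSymY i)) U₁) :
    Ids3124 𝔬 U₁ :=
  ids3124_of_pins_one' i (trBasis N) (cR39_trBasis_pos hN).ne' B cfg (fun z w => parSymY_one i z w) (fun s s' => parBY_one i s s')
    (GpY_one_liftY i (parSymY i) fun z w => parSymY_one i z w) hΔ 𝔬 hU₁ hG1 hQ hQs hDv hDvs hR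

/-- ★★★ **THE FULL SECT.-D SCHEMA `Identities 𝔬 U₁` AT `U = 1`, NO SIDE CONDITION LEFT**: for a letter record pinned at a configuration reading `1`
to node00-def-Y's sixteen coordinate models of record (the hypotheses `hG0 … hR` of n06-l's `identitiesDef_of_pins`, verbatim), the thirteen
fields hold — the ten of `IdentitiesDef` by `identitiesDef_of_pins` with its four units and its `G`-valuedness DISCHARGED at `U = 1` (def-Y's
`isUnit_deltaAY_one ∕ deltaPiAY_one' ∕ isUnit_deltaOneY_one ∕ QGQOfY_G1Y_one`, n06-i's `isUnit_QGQY_one`; `1 ∈ U(N)`), the three of `Ids3124`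
by `ids3124_of_pins_one`.  So the `Identities` conjunct of the certificate's rows-20–21 model binder is INHABITED at the trivial background of
every member. [cite: Balaban1985BackgroundPropagators, (3.120)–(3.130) pp.419–421, (3.124) p.420, (3.147) p.425, (3.153) p.426, Cor. 3.5 p.407; Balaban1984PropagatorsII, (2.31) p.227, (2.34)–(2.35) p.228] -/
theorem identities_of_pins_one (i : KIdx d ℓ hd hL b₀ b₁) (B : B9.Backgrounds) (cfg : B.Cfg → CfgY (Matrix (Fin N) (Fin N) ℂ) i)
    (Δ2 : BondOpY (Matrix (Fin N) (Fin N) ℂ) i) {g : B9.Geometry} {Y : Type}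
    (𝔬 : Ops g B (XBK (TrIdx N) i) Y (XHK (TrIdx N) i) (XSK (TrIdx N) i)) (U₁ : B.Cfg) (hN : 0 < N)
    (hU₁ : cfg U₁ = fun _ _ => 1) (hΔ : Δ2 (fun _ _ => 1) = 0)
    (hG0 : 𝔬.G0 U₁ = GcoK i (trBasis N) B cfg (GAY i (parSymY i) (parBY i) (GpY i (parSymY i))) U₁)
    (hS0 : 𝔬.S0 U₁ = S0coK i (trBasis N) B cfg (parSymY i) (parBY i) (GpY i (parSymY i)) U₁)
    (hTpi : 𝔬.Tpi U₁ = TpicoK i (trBasis N) B cfg (parSymY i) (GpY i (parSymY i)) U₁)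
    (hT2 : 𝔬.T2 U₁ = T2coK i (trBasis N) B cfg (parSymY i) (GpY i (parSymY i)) Δ2 U₁)
    (hGD : 𝔬.G U₁ = GcoK i (trBasis N) B cfg (GDY i (parSymY i) (parBY i) (GpY i (parSymY i))) U₁)
    (hG1 : 𝔬.G1 U₁ = GcoK i (trBasis N) B cfg (G1Y i (parSymY i) (parBY i) (GpY i (parSymY i)) Δ2) U₁)
    (hGG : 𝔬.GG U₁ = GcoK i (trBasis N) B cfg (GGY i (parSymY i) (parBY i) (GpY i (parSymY i)) Δ2) U₁)
    (hQ : 𝔬.Q U₁ = QcoKH i (trBasis N) B cfg (parBY i) U₁)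
    (hQs : 𝔬.Qstar U₁ = QscoKH i (trBasis N) B cfg (parBY i) U₁)
    (hC : 𝔬.C U₁ = CcoK i (trBasis N) B cfg (parSymY i) (parBY i) (GpY i (parSymY i)) U₁)
    (hC1 : 𝔬.C1 U₁ = C1coK i (trBasis N) B cfg (parSymY i) (parBY i) (GpY i (parSymY i)) Δ2 U₁)
    (hHm : 𝔬.Hm U₁ = HcoK i (trBasis N) B cfg (HDY i (parSymY i) (parBY i) (GpY i (parSymY i))) U₁)
    (hH1m : 𝔬.H1m U₁ = HcoK i (trBasis N) B cfg (H1Y i (parSymY i) (parBY i) (GpY i (parSymY i)) Δ2) U₁)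
    (hDv : 𝔬.Dv U₁ = DvcoKH i (trBasis N) B cfg U₁)
    (hDvs : 𝔬.Dvstar U₁ = DvscoKH i (trBasis N) B cfg U₁)
    (hR : 𝔬.R U₁ = RcoK i (trBasis N) B cfg (parSymY i) (GpY i (parSymY i)) U₁) :
    Identities 𝔬 U₁ := by
  have hparS : ∀ z w, parSymY (𝔸 := Matrix (Fin N) (Fin N) ℂ) i (fun _ _ => 1) z w = 1 := fun z w => parSymY_one i z w
  have hparB : ∀ s s', parBY (𝔸 := Matrix (Fin N) (Fin N) ℂ) i (fun _ _ => 1) s s' = 1 := fun s s' => parBY_one i s s'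
  have hGp := GpY_one_liftY i (parSymY (𝔸 := Matrix (Fin N) (Fin N) ℂ) i) hparS
  have hUa : IsUnit (deltaAY i (parSymY i) (parBY i) (GpY i (parSymY i)) (cfg U₁)) := by
    rw [hU₁]; exact isUnit_deltaAY_one i hparS hparB hGp
  have hUπ : IsUnit (deltaPiAY i (parSymY i) (parBY i) (GpY i (parSymY i)) (cfg U₁)) := by
    rw [hU₁, deltaPiAY_one']; exact isUnit_deltaAY_one i hparS hparB hGp
  have hU1 : IsUnit (deltaOneY i (parSymY i) (parBY i) (GpY i (parSymY i)) Δ2 (cfg U₁)) := by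
    rw [hU₁]; exact isUnit_deltaOneY_one i hparS hparB hGp hΔ
  have hUQ : IsUnit (QGQOfY i (parBY i) (G1Y i (parSymY i) (parBY i) (GpY i (parSymY i)) Δ2) (cfg U₁)) := by
    rw [hU₁, QGQOfY_G1Y_one i (parSymY i) (parBY i) (GpY i (parSymY i)) hΔ]; exact isUnit_QGQY_one i hparS hparB hGp
  have hU : ∀ μ x, cfg U₁ μ x ∈ B7Prop2Explicit.unitaryUnits (Matrix (Fin N) (Fin N) ℂ) := fun μ x => by
    rw [hU₁]; exact Subgroup.one_mem _
  exact identities_of_def_3124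
    (identitiesDef_of_pins i B cfg Δ2 𝔬 U₁ hN le_rfl hU hUa hUπ hU1 hUQ hG0 hS0 hTpi hT2 hGD hG1 hGG hQ hQs hC hC1 hHm hH1m hDv hDvs hR)
    (ids3124_of_pins_one i B cfg Δ2 𝔬 U₁ hN hU₁ hΔ hG1 hQ hQs hDv hDvs hR)

end Record

/-! ## §5 Non-degeneracy of the `U = 1` inhabitant: `R(1) ≠ 0` and `Q(U) ≠ 0` (v1.1; referee ref-A g24 READ-4: *"informative only with
R(1) ≠ 0 ∕ Q(1) ≠ 0"*) — so `QG₁DR = 0`, `RD*G₁Q* = 0`, `RD*G₁DR = R` at `U = 1` are not the identities `0 = 0` -/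

section NonDegeneracy

open B4Reflection242 (boxDom mem_boxDom blk)
open B6Geom246MultiLevelBox (blkOf blkOf_eq_iff_blk corner corner_mem blkOf_corner scale_bounds)
open B6Geom246MultiLevelTorus (label_bounds)
open B6MultiLevelBoxOperator (N0 aPrinted)
open B6MultiLevelTorusOperator (mlOpT N0_eq_bigSide_mul)
open B6Ineq288MultiLevelTorus (QM)
open B6Ineq268MultiLevelBox (W)
open B9Cor35AtOneInverseLetters (mlOpT_mul_G)

variable {d ℓ : ℕ} {hd : 1 ≤ d + 1} {hL : Odd (ℓ + 1) ∧ 1 < ℓ + 1} {b₀ b₁ : ℝ} (i : KIdx d ℓ hd hL b₀ b₁)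

/-- **`Q′♯` HAS A NON-ZERO KERNEL VECTOR**: every block of the member has at least two sites (levels `≥ 1`, `L = ℓ + 1 ≥ 2`, the box a union of
blocks), and the difference of their indicators is averaged to `0`. [cite: Balaban1984PropagatorsII, (2.14)–(2.17) p.225 («N(Q′) = {λ : Q′λ = 0}» is the gauge freedom); Balaban1985BackgroundPropagators, (3.21) p.394] -/
theorem exists_qpK_mulVec_eq_zero : ∃ ν : SiteY i → ℝ, ν ≠ 0 ∧ qpK i *ᵥ ν = 0 := by
  classical
  -- a block `s`, its corner `c`, and the neighbouring site `c + e₀` of the same block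
  let s : BlkY i := blkOf i.D.toDomains (toKT i).origin
  let c : SiteY i := ⟨corner i.D.toDomains s, corner_mem i.D.toDomains s⟩
  have hj1 : 1 ≤ s.1.1 := (scale_bounds i.D.toDomains s).1
  have hjk : s.1.1 ≤ i.k := (scale_bounds i.D.toDomains s).2
  have hL2 : (2 : ℤ) ≤ (((ℓ + 1) ^ s.1.1 : ℕ) : ℤ) := by
    have h1 : ℓ + 1 ≤ (ℓ + 1) ^ s.1.1 := Nat.le_self_pow (by omega) (ℓ + 1)
    have h2 : 2 ≤ ℓ + 1 := by have := i.hℓ; omega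
    exact_mod_cast h2.trans h1
  have hcμ : ∀ μ, c.1 μ = (((ℓ + 1) ^ s.1.1 : ℕ) : ℤ) * s.1.2 μ := fun μ => rfl
  let c'v : Fin (d + 1) → ℤ := fun μ => if μ = 0 then c.1 0 + 1 else c.1 μ
  have hc' : c'v ∈ boxDom (N0 ℓ i.Mh i.k i.P') := by
    rw [mem_boxDom]
    intro μ
    have hc := (mem_boxDom.1 c.2) μ
    by_cases hμ : μ = 0
    · subst hμ
      simp only [c'v, if_true]
      refine ⟨by linarith [hc.1], ?_⟩
      obtain ⟨q, hq⟩ : (((ℓ + 1) ^ s.1.1 : ℕ) : ℤ) ∣ (N0 ℓ i.Mh i.k i.P' 0 : ℤ) := by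
        have h1 : (ℓ + 1) ^ s.1.1 ∣ N0 ℓ i.Mh i.k i.P' 0 := by
          rw [N0_eq_bigSide_mul]
          exact Dvd.dvd.mul_right (B6MultiLevelTorusOperator.TDomains.pow_dvd_bigSide (le_trans hjk (Nat.le_succ _))) _
        exact_mod_cast h1
      have hlab := (label_bounds (D := i.D) s 0).2
      rw [hq, Int.mul_ediv_cancel_left _ (by positivity)] at hlab
      rw [hcμ, hq]
      nlinarith
    · simp only [c'v, if_neg hμ]
      exact hc
  let c' : SiteY i := ⟨c'v, hc'⟩
  have hblk : blkOf i.D.toDomains c' = s := by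
    rw [blkOf_eq_iff_blk]
    funext μ
    show c'v μ / (((ℓ + 1) ^ s.1.1 : ℕ) : ℤ) = s.1.2 μ
    have hL0 : (((ℓ + 1) ^ s.1.1 : ℕ) : ℤ) ≠ 0 := by positivity
    by_cases hμ : μ = 0
    · subst hμ
      simp only [c'v, if_true, hcμ]
      rw [add_comm, Int.add_mul_ediv_left _ _ hL0, Int.ediv_eq_zero_of_lt (by norm_num) (by linarith), zero_add]
    · simp only [c'v, if_neg hμ, hcμ]
      rw [Int.mul_ediv_cancel_left _ hL0]
  have hblk0 : blkOf i.D.toDomains c = s := blkOf_corner i.D.toDomains s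
  have hne : c ≠ c' := by
    intro h
    have h0 := congrArg (fun z : SiteY i => z.1 0) h
    simp only [c', c'v, if_true] at h0
    linarith
  refine ⟨Pi.single c 1 - Pi.single c' 1, ?_, ?_⟩
  · intro h
    have h0 := congr_fun h c
    rw [Pi.sub_apply, Pi.single_eq_same, Pi.single_eq_of_ne hne, sub_zero] at h0
    exact one_ne_zero h0
  · rw [Matrix.mulVec_sub, Matrix.mulVec_single_one, Matrix.mulVec_single_one]
    funext y
    show QM i.D y c - QM i.D y c' = 0
    simp only [QM, hblk, hblk0, sub_self]

/-- `R♯` fixes `Δ′_a ν` whenever `Q′♯ν = 0`: `R♯(Δ′_aν) = Δ′_aν − G′Q′*(Q′G′²Q′*)⁻¹Q′(G′Δ′_a)ν = Δ′_aν` ([4] (2.17): `R` is the identity on `Δ′_a N(Q′)`).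
[cite: Balaban1984PropagatorsII, (2.17) p.225; Balaban1985BackgroundPropagators, (3.21)–(3.22) p.394] -/
theorem rK_mulVec_mlOpT_mulVec {ν : SiteY i → ℝ} (hν : qpK i *ᵥ ν = 0) :
    rK i *ᵥ (mlOpT (toKT i).NB ℓ (toKT i).k (toKT i).D.lev (aPrinted ℓ 1) *ᵥ ν) =
      mlOpT (toKT i).NB ℓ (toKT i).k (toKT i).D.lev (aPrinted ℓ 1) *ᵥ ν := by
  have hG : gpK i * mlOpT (toKT i).NB ℓ (toKT i).k (toKT i).D.lev (aPrinted ℓ 1) = 1 := mul_eq_one_comm.1 (mlOpT_mul_G i)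
  rw [rK_eq_one_sub, Matrix.sub_mulVec, Matrix.one_mulVec, sub_eq_self, Matrix.mulVec_mulVec, Matrix.mul_assoc, hG, Matrix.mul_one,
    ← Matrix.mulVec_mulVec, hν, Matrix.mulVec_zero]

/-- `Δ′_a` is injective on site functions (it is a unit: T1's `G′ = Δ′_a⁻¹`). [cite: Balaban1984PropagatorsII, p.225 («G′ = Δ′_a^{−1} is a well defined … operator»)] -/
theorem mlOpT_mulVec_ne_zero {ν : SiteY i → ℝ} (hν : ν ≠ 0) :
    mlOpT (toKT i).NB ℓ (toKT i).k (toKT i).D.lev (aPrinted ℓ 1) *ᵥ ν ≠ 0 := by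
  intro h
  have hG : gpK i * mlOpT (toKT i).NB ℓ (toKT i).k (toKT i).D.lev (aPrinted ℓ 1) = 1 := mul_eq_one_comm.1 (mlOpT_mul_G i)
  have h1 := congrArg (fun v => gpK i *ᵥ v) h
  simp only [Matrix.mulVec_mulVec, hG, Matrix.one_mulVec, Matrix.mulVec_zero] at h1
  exact hν h1

/-- ★ **`R♯ ≠ 0`**: p21's `1 − P` is a non-zero projection on NODE 00's box (it fixes `Δ′_a ν ≠ 0` for the kernel vector `ν` of `Q′♯`).
[cite: Balaban1984PropagatorsII, (2.17) p.225; Balaban1985BackgroundPropagators, (3.21) p.394, (3.25) p.394] -/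
theorem rK_ne_zero : rK i ≠ 0 := by
  obtain ⟨ν, hν0, hν⟩ := exists_qpK_mulVec_eq_zero i
  intro h
  have h1 := rK_mulVec_mlOpT_mulVec i hν
  rw [h, Matrix.zero_mulVec] at h1
  exact mlOpT_mulVec_ne_zero i hν0 h1.symm

variable {𝔸 : Type} [NormedRing 𝔸] [NormedAlgebra ℂ 𝔸] [CompleteSpace 𝔸]

omit [CompleteSpace 𝔸] in
/-- a product form `f ⊗ 1` with `f ≠ 0` is non-zero in a non-trivial fibre. [cite: Balaban1985BackgroundPropagators, (3.39) p.397, bookkeeping] -/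
private theorem liftY_one_ne_zero [Nontrivial 𝔸] {X : Type} {f : X → ℝ} (hf : f ≠ 0) : liftY f (1 : 𝔸) ≠ 0 := by
  obtain ⟨z, hz⟩ := Function.ne_iff.1 hf
  intro h
  have h1 := congr_fun h z
  rw [liftY_apply, Pi.zero_apply, smul_eq_zero] at h1
  rcases h1 with h1 | h1
  · exact hz (by exact_mod_cast h1)
  · exact one_ne_zero h1

/-- ★★ **`R(1) ≠ 0` FOR def-Y's LETTER** (any site transporters trivial at `1`, any `G′` with the printed `U = 1` clause; non-trivial fibre): the
projection of (3.25) at the trivial background is p21's `R♯ ≠ 0` lifted. [cite: Balaban1985BackgroundPropagators, (3.21) p.394, (3.25) p.394, Cor. 3.5 p.407; Balaban1984PropagatorsII, (2.17) p.225] -/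
theorem RY_one_ne_zero [Nontrivial 𝔸] {parS : SiteParY 𝔸 i} {Gp : SiteOpY 𝔸 i} (hparS : ∀ z w, parS (fun _ _ => 1) z w = 1)
    (hGp : ∀ (f : SiteY i → ℝ) (E : 𝔸), Gp (fun _ _ => 1) (liftY f E) = liftY ((toKT i).G *ᵥ f) E) :
    RY i parS Gp (fun _ _ => 1) ≠ 0 := by
  obtain ⟨ν, hν0, hν⟩ := exists_qpK_mulVec_eq_zero i
  have hf := rK_mulVec_mlOpT_mulVec i hν
  have hf0 := mlOpT_mulVec_ne_zero i hν0
  intro h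
  have h1 := congrArg (fun T => T (liftY (mlOpT (toKT i).NB ℓ (toKT i).k (toKT i).D.lev (aPrinted ℓ 1) *ᵥ ν) (1 : 𝔸))) h
  simp only [RY_one i hparS hGp, liftMatY_liftY, hf, LinearMap.zero_apply] at h1
  exact liftY_one_ne_zero hf0 h1

/-- ★★ **`Q(U) ≠ 0` FOR def-Y's LETTER AT EVERY CONFIGURATION** (non-trivial fibre): node00-def-Y's `QY_surjective` (the averaging of (3.14)–(3.15) is
onto the index-bond functions) and r03's `bondIdx_nonempty` (every domain sequence has an index bond). [cite: Balaban1985BackgroundPropagators, (3.14)–(3.15) p.393; Balaban1984PropagatorsII, (2.3) p.224, (2.6) p.224] -/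
theorem QY_ne_zero [Nontrivial 𝔸] (parB : BondParY 𝔸 i) (U : CfgY 𝔸 i) : QY i parB U ≠ 0 := by
  classical
  obtain ⟨ι⟩ := B9Thm39ReadingCoords.bondIdx_nonempty (domT i.hN i.D i.hk)
  intro h
  obtain ⟨f, hf⟩ := QY_surjective i parB U (Pi.single ι (1 : 𝔸))
  rw [h, LinearMap.zero_apply] at hf
  have h1 := congr_fun hf ι
  rw [Pi.zero_apply, Pi.single_eq_same] at h1
  exact zero_ne_one h1

end NonDegeneracy

/-! ## §6 … and at the pins: dag-n06-d's coordinate functor is faithful on constant families -/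

section PinsNonDegeneracy

variable {𝔸 : Type} [NormedRing 𝔸] [NormedAlgebra ℂ 𝔸] [CompleteSpace 𝔸] [FiniteDimensional ℝ 𝔸]
variable {κ : Type} [Fintype κ]
variable {d ℓ : ℕ} {hd : 1 ≤ d + 1} {hL : Odd (ℓ + 1) ∧ 1 < ℓ + 1} {b₀ b₁ : ℝ}

omit [CompleteSpace 𝔸] [FiniteDimensional ℝ 𝔸] in
/-- ★ **THE MIXED COORDINATE MODEL OF A NON-ZERO CONSTANT FAMILY IS NON-ZERO** (faithfulness: every `𝔸`-valued function is re-assembled from its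
coordinates, `Module.Basis.sum_repr`). [cite: Balaban1985BackgroundPropagators, (3.42) p.397, dictionary; Balaban1984PropagatorsII, (2.51) p.232] -/
theorem coordOpKH_const_ne_zero (b : Module.Basis κ ℝ 𝔸) {T T' D' : Type} [Fintype T'] [Nonempty D'] {A : (T' → 𝔸) →ₗ[ℝ] (T → 𝔸)}
    (hA : A ≠ 0) : coordOpKH b (fun _ : D' => A) ≠ 0 := by
  classical
  obtain ⟨Φ, hΦ⟩ : ∃ Φ, A Φ ≠ 0 := not_forall.1 fun h => hA (LinearMap.ext h)
  obtain ⟨x, hx⟩ := Function.ne_iff.1 hΦ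
  obtain ⟨c, hc⟩ : ∃ c, b.repr (A Φ x) c ≠ 0 := not_forall.1 fun h => hx (b.repr.map_eq_zero_iff.1 (Finsupp.ext h))
  obtain ⟨ν⟩ := ‹Nonempty D'›
  intro h
  have hf : assembleK b ν c (fun p : T' × D' × κ × κ => b.repr (Φ p.1) p.2.2.1) = Φ := by
    funext z
    simp only [assembleK]
    exact b.sum_repr (Φ z)
  have h1 := congrArg (fun F => F (fun p : T' × D' × κ × κ => b.repr (Φ p.1) p.2.2.1) (x, ν, c, c)) h
  simp only [coordOpKH_apply, hf, LinearMap.zero_apply, Pi.zero_apply] at h1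
  exact hc h1

omit [CompleteSpace 𝔸] [FiniteDimensional ℝ 𝔸] in
/-- the plain coordinate model of a non-zero constant family is non-zero. [cite: Balaban1985BackgroundPropagators, (3.42) p.397, dictionary] -/
theorem coordOpK_const_ne_zero (b : Module.Basis κ ℝ 𝔸) {T D' : Type} [Fintype T] [Nonempty D'] {A : Module.End ℝ (T → 𝔸)}
    (hA : A ≠ 0) : coordOpK b (fun _ : D' => A) ≠ 0 := by
  rw [← coordOpKH_eq_coordOpK]
  exact coordOpKH_const_ne_zero b hA

omit [CompleteSpace 𝔸] [FiniteDimensional ℝ 𝔸] [Fintype κ] in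
/-- a non-zero ℂ-linear map restricts to a non-zero ℝ-linear map. [folklore] -/
private theorem restrictScalars_ne_zero {T T' : Type} {f : (T → 𝔸) →ₗ[ℂ] (T' → 𝔸)} (hf : f ≠ 0) : f.restrictScalars ℝ ≠ 0 := by
  intro h
  exact hf (LinearMap.ext fun v => LinearMap.congr_fun h v)

/-- ★★ **AT THE PINS, `𝔬.R U₁ ≠ 0`** — the pinned model of `R(U)` at a configuration reading `1` (`cR39 b ≠ 0`, non-trivial fibre): the `U = 1` inhabitant
of `hR : RD*G₁DR = R` is not `0 = 0`. [cite: Balaban1985BackgroundPropagators, (3.25) p.394, (3.147) p.425, Cor. 3.5 p.407; Balaban1984PropagatorsII, (2.17) p.225, (2.31) p.227] -/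
theorem R_pins_one_ne_zero [Nontrivial 𝔸] (i : KIdx d ℓ hd hL b₀ b₁) (b : Module.Basis κ ℝ 𝔸) (hc : cR39 b ≠ 0) (B : B9.Backgrounds)
    (cfg : B.Cfg → CfgY 𝔸 i) {parS : SiteParY 𝔸 i} {Gp : SiteOpY 𝔸 i} (hparS : ∀ z w, parS (fun _ _ => 1) z w = 1)
    (hGp : ∀ (f : SiteY i → ℝ) (E : 𝔸), Gp (fun _ _ => 1) (liftY f E) = liftY ((toKT i).G *ᵥ f) E)
    {g : B9.Geometry} {Y : Type} (𝔬 : Ops g B (XBK κ i) Y (XHK κ i) (XSK κ i)) {U₁ : B.Cfg} (hU₁ : cfg U₁ = fun _ _ => 1)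
    (hR : 𝔬.R U₁ = RcoK i b B cfg parS Gp U₁) : 𝔬.R U₁ ≠ 0 := by
  rw [hR, RcoK, hU₁]
  exact smul_ne_zero (inv_ne_zero hc) (coordOpK_const_ne_zero b (restrictScalars_ne_zero (RY_one_ne_zero i hparS hGp)))

/-- ★★ **AT THE PINS, `𝔬.Q U₁ ≠ 0`** (any configuration; `cR39 b ≠ 0`, non-trivial fibre): the `U = 1` inhabitant of `h124Q : QG₁DR = 0` has a non-zero
left letter. [cite: Balaban1985BackgroundPropagators, (3.14)–(3.15) p.393, (3.124) p.420; Balaban1984PropagatorsII, (2.34) p.228] -/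
theorem Q_pins_ne_zero [Nontrivial 𝔸] (i : KIdx d ℓ hd hL b₀ b₁) (b : Module.Basis κ ℝ 𝔸) (hc : cR39 b ≠ 0) (B : B9.Backgrounds)
    (cfg : B.Cfg → CfgY 𝔸 i) (parB : BondParY 𝔸 i) {g : B9.Geometry} {Y : Type} (𝔬 : Ops g B (XBK κ i) Y (XHK κ i) (XSK κ i))
    {U₁ : B.Cfg} (hQ : 𝔬.Q U₁ = QcoKH i b B cfg parB U₁) : 𝔬.Q U₁ ≠ 0 := by
  rw [hQ, QcoKH]
  exact smul_ne_zero (inv_ne_zero hc) (coordOpKH_const_ne_zero b (restrictScalars_ne_zero (QY_ne_zero i parB (cfg U₁))))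

end PinsNonDegeneracy

end

end Literature.MathematicalPhysics.QuantumFieldTheory.Balaban1983to89.B9Ids3124AtOne
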